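import Mathlib
import Summits.ValiantsHypothesis.ValiantsHypothesis.Theorems.RigidityForcesSymmetryRankRigidMinimalReprLaplaceFiveSeparatedCaptureDefs

/-!
# ValiantsHypothesis / RigidityForcesSymmetry — crux `LaplaceOptimalFive` (stmt-ValiantsHypothesis-24813), symmetric capture:
# LEADING MONOMIALS of a space of symmetric `5 × 5` matrices, the space `𝒵(U)` and its READ-OFF coordinates

Toolkit for the EQUAL-SPANS case of `CaptureIneqSym` (memo `pub/val-lit/lmr/NOTE-p4g17-24813-K32-symmetric-capture.md` §8,
CLAIM E; this seat's files `…SeparatedCaptureReadOff` and `…SeparatedCaptureEqualSpans` build on it).  A symmetric matrix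
`u : Fin 5 → Fin 5 → ℂ` is read through its upper entries `u i j`, `i ≤ j` (the "monomials" `x_i x_j` of the quadric); monomials
are WEIGHTED by `wt (i,j) = 5 j + i` (blocks by the top letter `j`, the square `x_j²` on top of block `j`); `deg u = 1 + wt` of the
leading monomial (`0` for `u = 0`); `LM U` is the finite set of leading monomials of a subspace `U`.

* `wt_injective`, `wt_lt_deg_of_ne`, `entry_eq_zero_of_deg_le(')`, `exists_lead`, `lead_ne_zero`;
* `LM`, `lead_mem_LM`, ★ `card_LM_le_finrank` — DISTINCT LEADING MONOMIALS ARE LINEARLY INDEPENDENT (`#LM U ≤ finrank U`);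
* `Zsp U` — the space `𝒵(U)` of 5-tuples `Q : Fin 5 → U` with `Q_c(a,a) + 2·Q_a(a,c) = 0` for all letters `a, c` (exactly the
  tuples whose symmetrised placement `(p,q,r) ↦ Q_r(p,q) + Q_q(p,r) + Q_p(q,r)` vanishes at every word with a repeated letter);
* `L3_finite_form` — FINITE FORM of membership in `L₃(U₀₁,U₀₂,U₁₂)`: `T(p,q,r) = A_r(p,q) + B_q(p,r) + C_p(q,r)` with
  `A_a ∈ U₀₁`, `B_a ∈ U₀₂`, `C_a ∈ U₁₂` (the span is exhausted by such tensors);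
* `RO1 U`, `RO2 U`, `RO U` — the READ-OFF coordinates `(b, x_a x_c)`: `x_a x_c ∈ LM U` a genuine pair and `b ∉ {a,c}` (type 1), or
  `b ∈ {a,c}` with the square `x_b² ∈ LM U` (type 2); ★ `card_RO_le` : `#RO U ≤ 3·#LM U` once `#LM U ≤ 4`.

Honest framing.  Linear algebra on `Sym²(ℂ⁵)`; by itself closes nothing; `CaptureIneqSym`, K1 on `K₃ ⊔ K₂`, `LaplaceOptimalFive`
(OPEN · CONTESTED 72/120), `VP ≠ VNP` are NOT proved.  The `def`s are local bookkeeping (an index type, a weight, finite sets, one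
submodule) in the manner of ✓ `…SeparatedCaptureDefs` / ✓ `…TwoK2Hub`; no structure / instance / notation / axiom; Mathlib +
✓ `…SeparatedCaptureDefs` only.
-/

set_option linter.dupNamespace false
set_option autoImplicit false

namespace Summit.ValiantsHypothesis.ValiantsHypothesis.Theorems.RigidityForcesSymmetryRankRigidMinimalRepr

namespace LaplaceFiveSeparatedCapture

open Finset

noncomputable section

/-- Upper index set: the monomials `x_i x_j`, `i ≤ j`. -/
abbrev J : Type := {x : Fin 5 × Fin 5 // x.1 ≤ x.2}

/-- The weight of the monomial `x_i x_j` (`i ≤ j`): `5 j + i` (top letter first). -/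
def wt (m : J) : ℕ := 5 * (m.1.2 : ℕ) + (m.1.1 : ℕ)

/-- The weight is injective on monomials. [folklore] -/
lemma wt_injective : Function.Injective wt := by
  rintro ⟨⟨i, j⟩, hij⟩ ⟨⟨k, l⟩, hkl⟩ h
  simp only [wt] at h
  have hi := i.isLt; have hj := j.isLt; have hk := k.isLt; have hl := l.isLt
  have h1 : (j : ℕ) = l := by omega
  have h2 : (i : ℕ) = k := by omega
  exact Subtype.ext (Prod.ext (Fin.ext h2) (Fin.ext h1))

/-- The upper support of a matrix: the monomials `x_i x_j`, `i ≤ j`, with `u i j ≠ 0`. -/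
def jsupp (u : Fin 5 → Fin 5 → ℂ) : Finset J := Finset.univ.filter (fun m => u m.1.1 m.1.2 ≠ 0)

/-- `deg u = 1 + (largest weight in the upper support)`, and `0` when the upper support is empty. -/
def deg (u : Fin 5 → Fin 5 → ℂ) : ℕ := (jsupp u).sup (fun m => wt m + 1)

/-- Membership in the upper support. [folklore] -/
lemma mem_jsupp {u : Fin 5 → Fin 5 → ℂ} {m : J} : m ∈ jsupp u ↔ u m.1.1 m.1.2 ≠ 0 := by
  simp [jsupp]

/-- A nonzero upper entry bounds the degree from below. [folklore] -/
lemma wt_lt_deg_of_ne {u : Fin 5 → Fin 5 → ℂ} {m : J} (h : u m.1.1 m.1.2 ≠ 0) : wt m < deg u := by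
  have : wt m + 1 ≤ deg u := Finset.le_sup (f := fun m => wt m + 1) (mem_jsupp.mpr h)
  omega

/-- Upper entries of weight `≥ deg u` vanish. [folklore] -/
lemma entry_eq_zero_of_deg_le {u : Fin 5 → Fin 5 → ℂ} {m : J} (h : deg u ≤ wt m) : u m.1.1 m.1.2 = 0 := by
  by_contra hne
  have := wt_lt_deg_of_ne hne
  omega

/-- Entry form of `entry_eq_zero_of_deg_le`: `u i j = 0` for `i ≤ j` with `deg u ≤ 5 j + i`. [folklore] -/
lemma entry_eq_zero_of_deg_le' {u : Fin 5 → Fin 5 → ℂ} (i j : Fin 5) (hij : i ≤ j)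
    (h : deg u ≤ 5 * (j : ℕ) + (i : ℕ)) : u i j = 0 :=
  entry_eq_zero_of_deg_le (m := ⟨(i, j), hij⟩) h

/-- A symmetric matrix with empty upper support is zero. [folklore] -/
lemma eq_zero_of_jsupp_eq_empty {u : Fin 5 → Fin 5 → ℂ} (hu : ∀ p q, u p q = u q p)
    (h : jsupp u = ∅) : u = 0 := by
  funext p q
  rcases le_total p q with hpq | hqp
  · have : (⟨(p, q), hpq⟩ : J) ∉ jsupp u := by rw [h]; exact Finset.notMem_empty _
    simpa [mem_jsupp] using this
  · have : (⟨(q, p), hqp⟩ : J) ∉ jsupp u := by rw [h]; exact Finset.notMem_empty _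
    rw [hu]; simpa [mem_jsupp] using this

/-- A nonzero symmetric matrix has a LEADING monomial: `deg u = wt m + 1` with `u m ≠ 0`. [folklore] -/
lemma exists_lead {u : Fin 5 → Fin 5 → ℂ} (hu : ∀ p q, u p q = u q p) (h0 : u ≠ 0) :
    ∃ m : J, deg u = wt m + 1 ∧ u m.1.1 m.1.2 ≠ 0 := by
  have hne : (jsupp u).Nonempty := by
    rw [Finset.nonempty_iff_ne_empty]
    intro h; exact h0 (eq_zero_of_jsupp_eq_empty hu h)
  obtain ⟨m, hm, hmax⟩ := Finset.exists_mem_eq_sup (jsupp u) hne (fun m => wt m + 1)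
  exact ⟨m, hmax, mem_jsupp.mp hm⟩

/-- If `deg u = wt m + 1` then the entry at `m` is nonzero (the leading monomial is unique). [folklore] -/
lemma lead_ne_zero {u : Fin 5 → Fin 5 → ℂ} (hu : ∀ p q, u p q = u q p) {m : J} (h : deg u = wt m + 1) :
    u m.1.1 m.1.2 ≠ 0 := by
  have h0 : u ≠ 0 := by
    intro hz
    have : deg u = 0 := by
      simp [deg, jsupp, hz]
    omega
  obtain ⟨m', hm', hne⟩ := exists_lead hu h0
  have : m' = m := wt_injective (by omega)
  rw [← this]; exact hne

/-- A nonzero symmetric matrix has positive degree. [folklore] -/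
lemma deg_pos_of_ne_zero {u : Fin 5 → Fin 5 → ℂ} (hu : ∀ p q, u p q = u q p) (h0 : u ≠ 0) : 0 < deg u := by
  obtain ⟨m, hm, _⟩ := exists_lead hu h0
  omega

/-- The zero matrix has degree `0`. [folklore] -/
lemma deg_zero : deg (0 : Fin 5 → Fin 5 → ℂ) = 0 := by
  simp [deg, jsupp]

/-! ### The leading monomials of a subspace -/

open scoped Classical in
/-- The LEADING MONOMIALS of a subspace `U`: the monomials `m` with `deg u = wt m + 1` for some `u ∈ U`. -/
def LM (U : Submodule ℂ (Fin 5 → Fin 5 → ℂ)) : Finset J :=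
  Finset.univ.filter (fun m => ∃ u ∈ U, deg u = wt m + 1)

/-- Membership in `LM U`. [folklore] -/
lemma mem_LM {U : Submodule ℂ (Fin 5 → Fin 5 → ℂ)} {m : J} : m ∈ LM U ↔ ∃ u ∈ U, deg u = wt m + 1 := by
  simp [LM]

/-- The leading monomial of a nonzero symmetric element of `U` lies in `LM U`. [folklore] -/
lemma lead_mem_LM {U : Submodule ℂ (Fin 5 → Fin 5 → ℂ)} {u : Fin 5 → Fin 5 → ℂ} (hu : u ∈ U) {m : J}
    (h : deg u = wt m + 1) : m ∈ LM U :=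
  mem_LM.mpr ⟨u, hu, h⟩

/-- DISTINCT LEADING MONOMIALS ARE LINEARLY INDEPENDENT: `#LM U ≤ finrank U` (for a space of symmetric matrices). [folklore] -/
theorem card_LM_le_finrank (U : Submodule ℂ (Fin 5 → Fin 5 → ℂ)) (hU : ∀ u ∈ U, ∀ p q, u p q = u q p) :
    (LM U).card ≤ Module.finrank ℂ U := by
  classical
  -- choose representatives
  have hrep : ∀ m : LM U, ∃ u : U, deg (u : Fin 5 → Fin 5 → ℂ) = wt m.1 + 1 := by
    rintro ⟨m, hm⟩
    obtain ⟨u, hu, h⟩ := mem_LM.mp hm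
    exact ⟨⟨u, hu⟩, h⟩
  choose v hv using hrep
  have hli : LinearIndependent ℂ v := by
    rw [linearIndependent_iff']
    intro s g hsum
    by_contra hne
    push Not at hne
    obtain ⟨i₁, hi₁s, hgi₁⟩ := hne
    -- the index of maximal weight among those with nonzero coefficient
    have hne' : (s.filter (fun i => g i ≠ 0)).Nonempty := ⟨i₁, Finset.mem_filter.mpr ⟨hi₁s, hgi₁⟩⟩
    obtain ⟨i₀, hi₀, hmax⟩ := Finset.exists_max_image (s.filter (fun i => g i ≠ 0)) (fun i => wt i.1) hne'
    have hi₀s : i₀ ∈ s := (Finset.mem_filter.mp hi₀).1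
    have hgi₀ : g i₀ ≠ 0 := (Finset.mem_filter.mp hi₀).2
    -- evaluate the vanishing combination at the monomial of i₀
    have heval : (∑ i ∈ s, g i • v i : U).1 i₀.1.1.1 i₀.1.1.2 = 0 := by
      rw [hsum]; rfl
    have hexp : (∑ i ∈ s, g i • v i : U).1 i₀.1.1.1 i₀.1.1.2
        = ∑ i ∈ s, g i * (v i : Fin 5 → Fin 5 → ℂ) i₀.1.1.1 i₀.1.1.2 := by
      rw [Submodule.coe_sum]
      simp only [Submodule.coe_smul, Finset.sum_apply, Pi.smul_apply, smul_eq_mul]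
    rw [hexp] at heval
    have hsingle : ∑ i ∈ s, g i * (v i : Fin 5 → Fin 5 → ℂ) i₀.1.1.1 i₀.1.1.2
        = g i₀ * (v i₀ : Fin 5 → Fin 5 → ℂ) i₀.1.1.1 i₀.1.1.2 := by
      apply Finset.sum_eq_single_of_mem _ hi₀s
      intro i his hii₀
      by_cases hgi : g i = 0
      · rw [hgi, zero_mul]
      · have hle : wt i.1 ≤ wt i₀.1 := hmax i (Finset.mem_filter.mpr ⟨his, hgi⟩)
        have hneq : wt i.1 ≠ wt i₀.1 := fun h => hii₀ (Subtype.ext (wt_injective h))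
        have hlt : wt i.1 < wt i₀.1 := lt_of_le_of_ne hle hneq
        have hdeg : deg (v i : Fin 5 → Fin 5 → ℂ) ≤ wt i₀.1 := by rw [hv i]; omega
        rw [entry_eq_zero_of_deg_le hdeg, mul_zero]
    rw [hsingle] at heval
    rcases mul_eq_zero.mp heval with h | h
    · exact hgi₀ h
    · exact lead_ne_zero (hU _ (v i₀).2) (hv i₀) h
  have := hli.fintype_card_le_finrank
  simpa [Fintype.card_coe] using this

/-! ### The space `𝒵(U)` and its read-off coordinates -/

/-- `𝒵(U)`: 5-tuples `Q = (Q_b)_b` of elements of `U` with `Q_c(a,a) + 2·Q_a(a,c) = 0` for all letters `a, c`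
(for `a = c`: `Q_a(a,a) = 0`).  These are exactly the tuples whose symmetrised placement vanishes at repeated letters. -/
def Zsp (U : Submodule ℂ (Fin 5 → Fin 5 → ℂ)) : Submodule ℂ (Fin 5 → Fin 5 → Fin 5 → ℂ) where
  carrier := {Q | (∀ b, Q b ∈ U) ∧ ∀ a c : Fin 5, Q c a a + 2 * Q a a c = 0}
  add_mem' := by
    rintro Q Q' ⟨hQ, hE⟩ ⟨hQ', hE'⟩
    refine ⟨fun b => U.add_mem (hQ b) (hQ' b), fun a c => ?_⟩
    simp only [Pi.add_apply]
    linear_combination hE a c + hE' a c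
  zero_mem' := ⟨fun _ => U.zero_mem, fun a c => by simp⟩
  smul_mem' := by
    rintro r Q ⟨hQ, hE⟩
    refine ⟨fun b => U.smul_mem r (hQ b), fun a c => ?_⟩
    simp only [Pi.smul_apply, smul_eq_mul]
    linear_combination r * hE a c

/-- Membership in `𝒵(U)`. [folklore] -/
lemma mem_Zsp {U : Submodule ℂ (Fin 5 → Fin 5 → ℂ)} {Q : Fin 5 → Fin 5 → Fin 5 → ℂ} :
    Q ∈ Zsp U ↔ (∀ b, Q b ∈ U) ∧ ∀ a c : Fin 5, Q c a a + 2 * Q a a c = 0 := Iff.rfl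

/-- The upper monomial `x_i x_j` packaged as an element of `J` (requires `i ≤ j`). -/
def mkJ (i j : Fin 5) (h : i ≤ j) : J := ⟨(i, j), h⟩

open scoped Classical in
/-- READ-OFF COORDINATES of type 1: `(b, x_a x_c)` with `x_a x_c ∈ LM U` a genuine pair (`a < c`) and `b ∉ {a, c}`. -/
def RO1 (U : Submodule ℂ (Fin 5 → Fin 5 → ℂ)) : Finset (Fin 5 × J) :=
  Finset.univ.filter (fun x => x.2 ∈ LM U ∧ x.2.1.1 < x.2.1.2 ∧ x.1 ≠ x.2.1.1 ∧ x.1 ≠ x.2.1.2)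

open scoped Classical in
/-- READ-OFF COORDINATES of type 2: `(b, x_a x_c)` with `x_a x_c ∈ LM U` a genuine pair, `b ∈ {a, c}` and the square `x_b²`
in `LM U`. -/
def RO2 (U : Submodule ℂ (Fin 5 → Fin 5 → ℂ)) : Finset (Fin 5 × J) :=
  Finset.univ.filter (fun x => x.2 ∈ LM U ∧ x.2.1.1 < x.2.1.2 ∧ (x.1 = x.2.1.1 ∨ x.1 = x.2.1.2) ∧
    mkJ x.1 x.1 le_rfl ∈ LM U)

/-- All read-off coordinates. -/
def RO (U : Submodule ℂ (Fin 5 → Fin 5 → ℂ)) : Finset (Fin 5 × J) := RO1 U ∪ RO2 U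

/-- Membership in `RO1 U`. [folklore] -/
lemma mem_RO1 {U : Submodule ℂ (Fin 5 → Fin 5 → ℂ)} {b : Fin 5} {m : J} :
    (b, m) ∈ RO1 U ↔ m ∈ LM U ∧ m.1.1 < m.1.2 ∧ b ≠ m.1.1 ∧ b ≠ m.1.2 := by
  simp [RO1]

/-- Membership in `RO2 U`. [folklore] -/
lemma mem_RO2 {U : Submodule ℂ (Fin 5 → Fin 5 → ℂ)} {b : Fin 5} {m : J} :
    (b, m) ∈ RO2 U ↔ m ∈ LM U ∧ m.1.1 < m.1.2 ∧ (b = m.1.1 ∨ b = m.1.2) ∧ mkJ b b le_rfl ∈ LM U := by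
  simp [RO2]

/-! ### Counting the read-off coordinates: `#RO U ≤ 3·#LM U` when `#LM U ≤ 4` -/

open scoped Classical in
/-- `#RO1 U ≤ 3 · #(pairs in LM U)`. [folklore] -/
lemma card_RO1_le (U : Submodule ℂ (Fin 5 → Fin 5 → ℂ)) :
    (RO1 U).card ≤ 3 * ((LM U).filter (fun m => m.1.1 < m.1.2)).card := by
  classical
  set P := (LM U).filter (fun m => m.1.1 < m.1.2) with hP
  have hsub : RO1 U ⊆ P.biUnion (fun m => ((Finset.univ.erase m.1.1).erase m.1.2).image (fun b => (b, m))) := by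
    rintro ⟨b, m⟩ hx
    rw [mem_RO1] at hx
    obtain ⟨hm, hlt, hb1, hb2⟩ := hx
    rw [Finset.mem_biUnion]
    refine ⟨m, Finset.mem_filter.mpr ⟨hm, hlt⟩, ?_⟩
    rw [Finset.mem_image]
    exact ⟨b, Finset.mem_erase.mpr ⟨hb2, Finset.mem_erase.mpr ⟨hb1, Finset.mem_univ b⟩⟩, rfl⟩
  refine (Finset.card_le_card hsub).trans ?_
  refine (Finset.card_biUnion_le).trans ?_
  have h3 : ∀ m ∈ P, (((Finset.univ.erase m.1.1).erase m.1.2).image (fun b => (b, m))).card ≤ 3 := by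
    intro m hm
    have hlt : m.1.1 < m.1.2 := (Finset.mem_filter.mp hm).2
    refine Finset.card_image_le.trans ?_
    rw [Finset.card_erase_of_mem (Finset.mem_erase.mpr ⟨ne_of_gt hlt, Finset.mem_univ _⟩),
      Finset.card_erase_of_mem (Finset.mem_univ _)]
    simp
  calc ∑ m ∈ P, (((Finset.univ.erase m.1.1).erase m.1.2).image (fun b => (b, m))).card
      ≤ ∑ m ∈ P, 3 := Finset.sum_le_sum h3
    _ = 3 * P.card := by rw [Finset.sum_const, smul_eq_mul, mul_comm]

open scoped Classical in
/-- `#RO2 U ≤ 3 · #(squares in LM U)` when `#LM U ≤ 4` (a square `x_b²` in `LM U` has at most `#LM U − 1 ≤ 3` pairs of `LM U`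
through its letter). [folklore] -/
lemma card_RO2_le (U : Submodule ℂ (Fin 5 → Fin 5 → ℂ)) (h4 : (LM U).card ≤ 4) :
    (RO2 U).card ≤ 3 * ((LM U).filter (fun m => ¬ m.1.1 < m.1.2)).card := by
  classical
  set S := (LM U).filter (fun m => ¬ m.1.1 < m.1.2) with hS
  -- a read-off of type 2 is determined by its letter `b` (with `x_b² ∈ LM U`) and a pair of `LM U` through `b`
  have hsub : RO2 U ⊆ S.biUnion (fun s => ((LM U).erase s).image (fun m => (s.1.1, m))) := by
    rintro ⟨b, m⟩ hx
    rw [mem_RO2] at hx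
    obtain ⟨hm, hlt, hb, hsq⟩ := hx
    rw [Finset.mem_biUnion]
    refine ⟨mkJ b b le_rfl, Finset.mem_filter.mpr ⟨hsq, by simp [mkJ]⟩, ?_⟩
    rw [Finset.mem_image]
    refine ⟨m, Finset.mem_erase.mpr ⟨?_, hm⟩, by simp [mkJ]⟩
    intro hms
    have : m.1.1 = m.1.2 := by
      have h1 : m.1.1 = b := by rw [hms]; rfl
      have h2 : m.1.2 = b := by rw [hms]; rfl
      rw [h1, h2]
    exact absurd hlt (by rw [this]; exact lt_irrefl _)
  refine (Finset.card_le_card hsub).trans ?_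
  refine (Finset.card_biUnion_le).trans ?_
  have h3 : ∀ s ∈ S, (((LM U).erase s).image (fun m => (s.1.1, m))).card ≤ 3 := by
    intro s hs
    have hsL : s ∈ LM U := (Finset.mem_filter.mp hs).1
    refine Finset.card_image_le.trans ?_
    rw [Finset.card_erase_of_mem hsL]
    omega
  calc ∑ s ∈ S, (((LM U).erase s).image (fun m => (s.1.1, m))).card
      ≤ ∑ s ∈ S, 3 := Finset.sum_le_sum h3
    _ = 3 * S.card := by rw [Finset.sum_const, smul_eq_mul, mul_comm]

/-- `#RO U ≤ 3 · #LM U` when `#LM U ≤ 4`. [folklore] -/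
lemma card_RO_le (U : Submodule ℂ (Fin 5 → Fin 5 → ℂ)) (h4 : (LM U).card ≤ 4) :
    (RO U).card ≤ 3 * (LM U).card := by
  classical
  have h := Finset.card_union_le (RO1 U) (RO2 U)
  have h1 := card_RO1_le U
  have h2 := card_RO2_le U h4
  have hsplit := Finset.card_filter_add_card_filter_not (s := LM U) (fun m : J => m.1.1 < m.1.2)
  unfold RO
  omega

/-! ### The finite form of `L3` membership -/

/-- FINITE FORM of membership in the triangle configuration space: `T ∈ L₃(U₀₁,U₀₂,U₁₂)` iff
`T(p,q,r) = A_r(p,q) + B_q(p,r) + C_p(q,r)` with `A_a ∈ U₀₁`, `B_a ∈ U₀₂`, `C_a ∈ U₁₂` for every letter `a`. [folklore] -/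
theorem L3_finite_form (U01 U02 U12 : Submodule ℂ (Fin 5 → Fin 5 → ℂ)) {T : Fin 5 → Fin 5 → Fin 5 → ℂ}
    (hT : T ∈ L3 U01 U02 U12) :
    ∃ A B C : Fin 5 → Fin 5 → Fin 5 → ℂ, (∀ a, A a ∈ U01) ∧ (∀ a, B a ∈ U02) ∧ (∀ a, C a ∈ U12) ∧
      ∀ p q r, T p q r = A r p q + B q p r + C p q r := by
  let S : Submodule ℂ (Fin 5 → Fin 5 → Fin 5 → ℂ) :=
    { carrier := {T | ∃ A B C : Fin 5 → Fin 5 → Fin 5 → ℂ, (∀ a, A a ∈ U01) ∧ (∀ a, B a ∈ U02) ∧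
        (∀ a, C a ∈ U12) ∧ ∀ p q r, T p q r = A r p q + B q p r + C p q r}
      add_mem' := by
        rintro T T' ⟨A, B, C, hA, hB, hC, hT⟩ ⟨A', B', C', hA', hB', hC', hT'⟩
        refine ⟨A + A', B + B', C + C', fun a => U01.add_mem (hA a) (hA' a), fun a => U02.add_mem (hB a) (hB' a),
          fun a => U12.add_mem (hC a) (hC' a), fun p q r => ?_⟩
        simp only [Pi.add_apply, hT, hT']
        ring
      zero_mem' := ⟨0, 0, 0, fun _ => U01.zero_mem, fun _ => U02.zero_mem, fun _ => U12.zero_mem,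
        fun p q r => by simp⟩
      smul_mem' := by
        rintro c T ⟨A, B, C, hA, hB, hC, hT⟩
        refine ⟨c • A, c • B, c • C, fun a => U01.smul_mem c (hA a), fun a => U02.smul_mem c (hB a),
          fun a => U12.smul_mem c (hC a), fun p q r => ?_⟩
        simp only [Pi.smul_apply, smul_eq_mul, hT]
        ring }
  have hle : L3 U01 U02 U12 ≤ S := by
    apply Submodule.span_le.mpr
    rintro T' hT'
    rcases hT' with (⟨u, hu, y, rfl⟩ | ⟨u, hu, y, rfl⟩) | ⟨u, hu, y, rfl⟩
    · refine ⟨fun a => y a • u, 0, 0, fun a => U01.smul_mem _ hu, fun _ => U02.zero_mem, fun _ => U12.zero_mem,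
        fun p q r => ?_⟩
      simp only [Pi.smul_apply, smul_eq_mul, Pi.zero_apply]; ring
    · refine ⟨0, fun a => y a • u, 0, fun _ => U01.zero_mem, fun a => U02.smul_mem _ hu, fun _ => U12.zero_mem,
        fun p q r => ?_⟩
      simp only [Pi.smul_apply, smul_eq_mul, Pi.zero_apply]; ring
    · refine ⟨0, 0, fun a => y a • u, fun _ => U01.zero_mem, fun _ => U02.zero_mem, fun a => U12.smul_mem _ hu,
        fun p q r => ?_⟩
      simp only [Pi.smul_apply, smul_eq_mul, Pi.zero_apply]; ring
  exact hle hT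

end

end LaplaceFiveSeparatedCapture

end Summit.ValiantsHypothesis.ValiantsHypothesis.Theorems.RigidityForcesSymmetryRankRigidMinimalRepr
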